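import Summits.Langlands.Langlands.Theorems.CliffordTateStructureInduced
import Summits.Langlands.Langlands.Theorems.CliffordTateStructureIsotypic
import Summits.Langlands.Langlands.Theorems.CliffordTateStructureIsotypicGeometric
import Summits.Langlands.Langlands.Theses.MonodromyDichotomy
import Summits.Langlands.Langlands.Theses.DescentTypeTrichotomy
import Literature.NumberTheory.GaloisRepresentations.ArtinRestriction
import HarnessLib

/-!
# The Clifford–Tate structure theorem (`MonodromyDichotomy.CliffordTateStructure` =
# `DescentTypeTrichotomy.CliffordTateStructure`, item stmt-Langlands-25620)

For an irreducible `ρ : Γ_K → GL_n(ℚ̄_ℓ)` (`n ≥ 2`, `K` ANY number field), unramified almost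
everywhere and de Rham at `ℓ`, which becomes reducible over some finite extension and is not
potentially scalar: EITHER `ρ ≅ Ind_{Γ_L}^{Γ_K} σ` with `[L:K] ≥ 2` and `σ` irreducible, unramified
a.e. and de Rham at `ℓ`, OR `ρ ≅ ρ₁ ⊗ ρ₂` with `ρ₁, ρ₂` irreducible of ranks `a, d ≥ 2`, unramified
a.e. and de Rham at `ℓ`, and `ρ₂` of finite image — both in characteristic-polynomial form
(`cliffordTateStructure_proof`, `cliffordTateStructure_proof'`).

Proof.  Pick `L` with `ρ|_{Γ_L}` reducible and let `N ◁ Γ_K` be the normal core of the open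
subgroup `res(Γ_L)` (open, normal, finite index; `ρ|_N` reducible).  By Clifford's dichotomy
(`isIsotypic_or_exists_imprimitivity`, file `CliffordTateStructureCliffordCore`) either an
isotypic component of `ρ|_N` and its open proper stabiliser form a system of imprimitivity — the
INDUCED case `exists_induce_of_imprimitivity` (file `CliffordTateStructureInduced`) — or `ρ|_N`
is isotypic; then `N` does not act by scalars (else `ρ` would be scalar on `Γ_{K̄^N}`,
`exists_mem_range_absGaloisRestrict_fixedField_iff`) and the ARTIN–KRONECKER case
`cliffordTate_isotypic` applies: the factorisation `Q ρ Q⁻¹ = ρ₁ ⊗ ρ₂` with `ρ₂` of finite image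
(`exists_kroneckerFactors`: twisted-Schur Kronecker frame, projective factor, Tate's lift
`H²(Γ_K, ℚ/ℤ) = 0`, continuity and irreducibility of the factors; file
`CliffordTateStructureIsotypic`) and the geometricity of both factors
(`isUnramifiedAt_and_isDeRhamFramed_of_finite_range`,
`isUnramifiedAt_and_isDeRhamFramed_leftFactor`; file `CliffordTateStructureIsotypicGeometric`).
[cite: Clifford1937, Thm. 1–3] [cite: Patrikis2019, Prop. 4.1.1]
[cite: SerreDurham1977, §6.1 Thm. 4 (Tate)] [cite: SerreLinearRepresentations1977, §7–8]
[cite: FontaineAsterisque223III, Exp. III Prop. 1.5.2] [cite: BrinonConrad2009, Prop. 6.3.8]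
-/

set_option autoImplicit false
set_option linter.dupNamespace false

noncomputable section

namespace Summit.Langlands.Langlands.Theorems

open Filter NumberField IsDedekindDomain Field Matrix
open Literature.NumberTheory.GaloisRepresentations Literature.NumberTheory.PAdicHodge
open scoped Kronecker MatrixGroups

/-! ### Lemmas for the reduction -/

section Lemmas

variable {k : Type*} [Field k] {G : Type*} [Group G] {V : Type*} [AddCommGroup V] [Module k V]

/-- Irreducibility descends from a subgroup `N` to any over-group: if `π|_N` is irreducible and
`N ≤ φ(H')`, then `π ∘ φ` is irreducible. [folklore] -/
theorem isIrreducible_comp_of_le_range (π : Representation k G V) (N : Subgroup G) {H' : Type*}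
    [Group H'] (φ : H' →* G) (hN : N ≤ φ.range) (h : (resN π N).IsIrreducible) :
    Representation.IsIrreducible (π.comp φ) := by
  haveI : Nontrivial V := (subsingleton_or_nontrivial V).resolve_left fun hV =>
    IsSimpleOrder.bot_ne_top (α := Subrepresentation (resN π N))
      (Subrepresentation.toSubmodule_injective (Subsingleton.elim _ _))
  haveI : Nontrivial (Subrepresentation (π.comp φ)) := by
    refine ⟨⟨⊥, ⊤, fun hbt => ?_⟩⟩
    have h1 := congrArg Subrepresentation.toSubmodule hbt
    exact bot_ne_top (h1 : (⊥ : Submodule k V) = ⊤)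
  refine ⟨fun W => ?_⟩
  let W' : Subrepresentation (resN π N) :=
    ⟨W.toSubmodule, fun n v hv => by
      obtain ⟨h', hh'⟩ := hN n.2
      have h1 : (resN π N) n v = (π.comp φ) h' v := by
        change π (n : G) v = π (φ h') v
        rw [hh']
      rw [h1]
      exact W.apply_mem_toSubmodule h' hv⟩
  rcases IsSimpleOrder.eq_bot_or_eq_top W' with hW | hW
  · left
    apply Subrepresentation.toSubmodule_injective
    exact (congrArg Subrepresentation.toSubmodule hW :
      W'.toSubmodule = (⊥ : Subrepresentation _).toSubmodule)
  · right
    apply Subrepresentation.toSubmodule_injective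
    exact (congrArg Subrepresentation.toSubmodule hW :
      W'.toSubmodule = (⊤ : Subrepresentation _).toSubmodule)

end Lemmas

/-! ### The isotypic (Artin–Kronecker) branch -/

set_option backward.isDefEq.respectTransparency false in
/-- **The isotypic branch of the Clifford–Tate structure theorem.**  For an irreducible
`ρ : Γ_K → GL_n(ℚ̄_ℓ)`, unramified almost everywhere and de Rham at `ℓ`, and an open normal
finite-index `N ◁ Γ_K` with `ρ|_N` ISOTYPIC, NOT irreducible and NOT scalar: `ρ ≅ ρ₁ ⊗ ρ₂` with
`ρ₁, ρ₂` irreducible of ranks `a, d ≥ 2`, unramified a.e. and de Rham at `ℓ`, `ρ₂` of finite image,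
and `charpoly ρ(g) = charpoly (ρ₁(g) ⊗ ρ₂(g))`. [cite: Clifford1937, Thm. 2–3]
[cite: Patrikis2019, Prop. 4.1.1] [cite: SerreDurham1977, §6.1 Thm. 4 (Tate)] -/
theorem cliffordTate_isotypic (K : Type) [Field K] [NumberField K] (n ℓ : ℕ) [Fact ℓ.Prime]
    (ρ : FramedGaloisRep K (PadicAlgCl ℓ) n) (hirr : ρ.toGaloisRep.IsIrreducible)
    (hgeo : (∀ᶠ v : HeightOneSpectrum (𝓞 K) in cofinite, ρ.IsUnramifiedAt v) ∧
      ∀ (v : HeightOneSpectrum (𝓞 K)) (hv : ((ℓ : ℕ) : 𝓞 K) ∈ v.asIdeal),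
        (fontainePstAdicCompletion v ℓ hv).IsDeRhamFramed (ρ.toLocal v))
    (N : Subgroup (absoluteGaloisGroup K)) [N.Normal] [N.FiniteIndex]
    (hNo : IsOpen (N : Set (absoluteGaloisGroup K)))
    (hiso : IsIsotypic (MonoidAlgebra (PadicAlgCl ℓ) N) (resN (FramedRep.toRepresentation ρ) N).asModule)
    (hNirr : ¬ (resN (FramedRep.toRepresentation ρ) N).IsIrreducible)
    (hNsc : ¬ ∀ g ∈ N, ∃ c : PadicAlgCl ℓ, ((ρ g : GL (Fin n) (PadicAlgCl ℓ)) :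
      Matrix (Fin n) (Fin n) (PadicAlgCl ℓ)) = c • (1 : Matrix (Fin n) (Fin n) (PadicAlgCl ℓ))) :
    ∃ (a d : ℕ) (ρ₁ : FramedGaloisRep K (PadicAlgCl ℓ) a) (ρ₂ : FramedGaloisRep K (PadicAlgCl ℓ) d),
      2 ≤ a ∧ 2 ≤ d ∧ n = a * d ∧ ρ₁.toGaloisRep.IsIrreducible ∧
      ((∀ᶠ v : HeightOneSpectrum (𝓞 K) in cofinite, ρ₁.IsUnramifiedAt v) ∧
        ∀ (v : HeightOneSpectrum (𝓞 K)) (hv : ((ℓ : ℕ) : 𝓞 K) ∈ v.asIdeal),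
          (fontainePstAdicCompletion v ℓ hv).IsDeRhamFramed (ρ₁.toLocal v)) ∧
      ρ₂.toGaloisRep.IsIrreducible ∧
      ((∀ᶠ v : HeightOneSpectrum (𝓞 K) in cofinite, ρ₂.IsUnramifiedAt v) ∧
        ∀ (v : HeightOneSpectrum (𝓞 K)) (hv : ((ℓ : ℕ) : 𝓞 K) ∈ v.asIdeal),
          (fontainePstAdicCompletion v ℓ hv).IsDeRhamFramed (ρ₂.toLocal v)) ∧
      (Set.range (fun g : absoluteGaloisGroup K => (ρ₂ g : GL (Fin d) (PadicAlgCl ℓ)))).Finite ∧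
      ∀ g : absoluteGaloisGroup K, FramedRep.charpoly ρ g =
        (((ρ₁ g : GL (Fin a) (PadicAlgCl ℓ)) : Matrix (Fin a) (Fin a) (PadicAlgCl ℓ)) ⊗ₖ
          ((ρ₂ g : GL (Fin d) (PadicAlgCl ℓ)) : Matrix (Fin d) (Fin d) (PadicAlgCl ℓ))).charpoly := by
  obtain ⟨a, d, ρ₁, ρ₂, Q, e, ha2, hd2, had, hirr₁, hirr₂, hfin, hconj⟩ :=
    exists_kroneckerFactors K n ℓ ρ hirr N hNo hiso hNirr hNsc
  have hgeo₂ := isUnramifiedAt_and_isDeRhamFramed_of_finite_range K ρ₂ hfin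
  have hgeo₁ := isUnramifiedAt_and_isDeRhamFramed_leftFactor K (by omega) ρ ρ₁ ρ₂ Q e hconj hfin
    hgeo.1 hgeo.2
  refine ⟨a, d, ρ₁, ρ₂, ha2, hd2, had, hirr₁, hgeo₁, hirr₂, hgeo₂, hfin, fun g => ?_⟩
  have h1 : FramedRep.charpoly ρ g = FramedRep.charpoly (FramedRep.conj Q ρ) g := by
    simp only [FramedRep.charpoly, FramedRep.conj_apply, Units.val_mul, Matrix.coe_units_inv]
    exact (Matrix.charpoly_units_conj Q _).symm
  rw [h1, FramedRep.charpoly, hconj g, Matrix.charpoly_reindex]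

/-! ### The structure theorem -/

set_option backward.isDefEq.respectTransparency false in
/-- **The Clifford–Tate structure theorem** (closes `MonodromyDichotomy.CliffordTateStructure`):
`N :=` normal core of `res(Γ_L)` for an `L` over which `ρ` becomes reducible; Clifford's dichotomy
for `ρ|_N` (`isIsotypic_or_exists_imprimitivity`); the non-isotypic case is the induced case
(`exists_induce_of_imprimitivity`), the isotypic case is `cliffordTate_isotypic` (non-scalar
because `ρ` is not potentially scalar). [cite: Clifford1937, Thm. 1–2] [cite: Patrikis2019, Prop. 4.1.1] -/
theorem cliffordTateStructure_proof :
    Summit.Langlands.Langlands.Theses.MonodromyDichotomy.CliffordTateStructure := by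
  intro K _ _ n hn ℓ _ ρ hirr hgeo hnot hnsc
  classical
  -- a field over which `ρ` becomes reducible
  push Not at hnot
  obtain ⟨L, _, _, _, hL⟩ := hnot
  haveI : CharZero L := charZero_of_injective_algebraMap (algebraMap K L).injective
  -- `N :=` the normal core of `res(Γ_L)`: open, normal
  set HL : Subgroup (absoluteGaloisGroup K) := (absGaloisRestrict K L).toMonoidHom.range with hHL
  have hHLo : IsOpen (HL : Set (absoluteGaloisGroup K)) := by
    rw [hHL, MonoidHom.coe_range]
    exact isOpen_range_absGaloisRestrict K L
  haveI : HL.FiniteIndex := by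
    rw [hHL]
    exact @Subgroup.finiteIndex_of_finite_quotient _ _ _
      (finite_quotient_range_absGaloisRestrict K L)
  set N : Subgroup (absoluteGaloisGroup K) := HL.normalCore with hN
  haveI : N.Normal := Subgroup.normalCore_normal HL
  haveI : N.FiniteIndex := Subgroup.finiteIndex_normalCore (H := HL)
  have hNo : IsOpen (N : Set (absoluteGaloisGroup K)) :=
    Subgroup.isOpen_of_isClosed_of_finiteIndex _
      (HL.normalCore_isClosed (Subgroup.isClosed_of_isOpen _ hHLo))
  have hNle : N ≤ HL := Subgroup.normalCore_le HL
  set π := FramedRep.toRepresentation ρ with hπ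
  haveI : π.IsIrreducible := hirr
  -- `ρ|_N` is reducible
  have hNirr : ¬ (resN π N).IsIrreducible := by
    intro h
    apply hL
    exact isIrreducible_comp_of_le_range π N (absGaloisRestrict K L).toMonoidHom hNle h
  -- Clifford's dichotomy
  rcases isIsotypic_or_exists_imprimitivity (π := π) (N := N) with
    hiso | ⟨U, H, hNH, hHt, hUb, -, hstab, hind, hsup⟩
  · -- isotypic: `N` does not act by scalars, and the branch applies
    right
    have hNsc : ¬ ∀ g ∈ N, ∃ c : PadicAlgCl ℓ, ((ρ g : GL (Fin n) (PadicAlgCl ℓ)) :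
        Matrix (Fin n) (Fin n) (PadicAlgCl ℓ)) = c • (1 : Matrix (Fin n) (Fin n) (PadicAlgCl ℓ)) := by
      intro hsc
      apply hnsc
      let M : IntermediateField K (AlgebraicClosure K) := IntermediateField.fixedField N
      haveI : FiniteDimensional K M := finiteDimensional_fixedField_of_isOpen N hNo
      haveI : NumberField M := NumberField.of_module_finite K M
      obtain ⟨g, hg⟩ := exists_mem_range_absGaloisRestrict_fixedField_iff N hNo
      refine ⟨M, inferInstance, inferInstance, inferInstance, fun σ => ?_⟩
      have h1 : absGaloisRestrict K M σ ∈ N := by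
        have h2 := (hg (absGaloisRestrict K M σ)).1 ⟨σ, rfl⟩
        have h3 := Subgroup.Normal.conj_mem inferInstance _ h2 g
        rwa [show g * (g⁻¹ * absGaloisRestrict K M σ * g) * g⁻¹ = absGaloisRestrict K M σ by group]
          at h3
      obtain ⟨c, hc⟩ := hsc _ h1
      exact ⟨c, by rw [FramedGaloisRep.restrictField_apply, hc]⟩
    exact cliffordTate_isotypic K n ℓ ρ hirr hgeo N hNo hiso hNirr hNsc
  · -- a proper system of imprimitivity: `ρ` is induced
    left
    exact exists_induce_of_imprimitivity K n ℓ ρ hirr hgeo H (Subgroup.isOpen_mono hNH hNo) hHt U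
      hUb hstab hind hsup

/-- The same theorem under its `DescentTypeTrichotomy` name (the shared item).
[cite: Clifford1937, Thm. 1–3] [cite: Patrikis2019, Prop. 4.1.1] -/
theorem cliffordTateStructure_proof' :
    Summit.Langlands.Langlands.Theses.DescentTypeTrichotomy.CliffordTateStructure :=
  cliffordTateStructure_proof

end Summit.Langlands.Langlands.Theorems

end
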